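import Mathlib.RingTheory.UniqueFactorizationDomain.Multiplicity
import Mathlib.RingTheory.Localization.FractionRing
import Mathlib.Tactic.LinearCombination
import Mathlib.Tactic.Positivity
import HarnessLib

/-!
# K4 crux `AdditiveRankZeroAtTwo` (19098), children C3″ (22617) / C1″ (22615): the DYADIC NON-NORM DESCENT at a prime element of ANY ramification index `e`
# over `2` with residue field `𝔽₂` — a unit `ε` with `π^{2e} ‖ ε − 1` is not of the form `x² − πμ·y²` (`π ∤ μ`), i.e. not a norm from `K(√(πμ))`
# (k4-w1 GEN 11's `Literature/NumberTheory/NumberFields/DyadicUnitSquaresRamifiedPrime.lean`, the case `e = 2`, with `e` freed; KERNEL, ring-theoretic)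
# (seat `bsd-2adic-k4-w2` GEN 15; `--supports stmt-BirchSwinnertonDyer-22617 --as helper`)

Cell `bsd-2adic`.  THEOREMS ONLY (no definition, no named fact, no `sorry`, no instance).  Purely ring-theoretic statements: `R` an integral domain
with well-founded divisibility (e.g. the integers of a number field), `π ∈ R` a PRIME element with `2 = π^e·w`, `π ∤ w`, `e ≥ 1` and `R/(π) = {0, 1}`
(hypothesis `∀ t, π ∣ t ∨ π ∣ t − 1`).  The local ring at `(π)` is then a totally ramified dyadic ring of index `e` with residue field `𝔽₂`, and the file
proves the elementary half of the dyadic Hilbert-symbol calculus used by the PARITY STEP `A₂ → A₃` of the narrow rank certificate (`e = 4`: the prime of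
`A₂ = ℚ(θ) ⊔ ℚ(ζ₁₆)⁺` above the degree-one unramified dyadic prime of a cubic point field), without completions:

* `exists_sq_sub_sq_eq_or_pow_dvd` — for `π`-units `a, c`: either `a² − c² = π^{2j}·ν` with `1 ≤ j < e`, `π ∤ ν`, or `π^{2e+1} ∣ a² − c²`
  (`a − c = π^{k+1}d₀`: exact order `2k+2` if `k < e − 1`, order `≥ 2e+1` otherwise since `d₀ + wc ≡ 1 + 1 = 2 ≡ 0`).  So NO unit square has
  `π`-order of `a² − 1` equal to `2e`: the class `1 + π^{2e}` (O'Meara's `1 + 4ρ`) is a non-square.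
* `not_pow_dvd_pow_mul_sub_of_not_dvd` — `π^{2j+1} ∤ π^{2j}ν − πμb²` for `π ∤ ν`, `π ∤ μ` (parities of the orders differ).
* `pow_succ_dvd_of_pow_dvd_mul_sq` — `π^{2e} ∣ πμb²` forces `π^{2e+1} ∣ πμb²` (`π ∤ μ`; the order `1 + 2v(b)` is odd).
* ★ `not_exists_sq_sub_mul_sq_of_pow_two_mul_dvd` — if `π^{2e} ∣ ε − 1`, `π^{2e+1} ∤ ε − 1` and `π ∤ μ` then there are no `a, b, c ∈ R`, `c ≠ 0`, with
  `a² − πμ·b² = c²ε`: descent on the power of `π` in `c`, then for `π ∤ c` the identity `c²(ε − 1) = (a² − c²) − πμb²` is impossible — the left side has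
  order exactly `2e`, the right side has order `2j < 2e` odd-obstructed, or `≥ 2e+1`.  («A unit `≡ 1 + 4ρ (mod 4π)` is not a norm from the ramified
  quadratic extension `K(√(π·unit))`»: `(ε, πμ)_𝔭 = −1`.)
* ★ `not_exists_sq_sub_mul_sq_fractionRing_of_pow_two_mul_dvd` — the same with `x, y` in the fraction field: `x² − πμ·y² ≠ ε` (O'Meara 63:10: the norms
  from `K(√m)` are the values `x² − m y²`).

HONEST FRAMING: elementary commutative algebra; nothing is asserted about any number field or curve; closes nothing; BSD is not proved by any of this.

References: [Omeara1963] §63A (63:1, 63:1a: squares of dyadic units modulo `4𝔭`; 63:3 the unit `1 + 4ρ`), §63B (63:10: norms from `F(√m)`);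
[Serre1973CourseArithmetic] Ch. II §3.3, Ch. III §1.2 (the model case `ℚ₂`); [NeukirchANT1999] Ch. V §3 (Hilbert symbols at dyadic places).
-/

set_option autoImplicit false
-- sibling precedent (`…NarrowRankLayerDyadicPrimes.lean`): the directory name repeats the summit name
set_option linter.dupNamespace false

namespace Summit.BirchSwinnertonDyer.BirchSwinnertonDyer.Theorems.AddKatoTwo.DyadicDescent

variable {R : Type*} [CommRing R]

section Residue

variable {π w : R} {e : ℕ}

/-- If `R/(π) = {0,1}` and `π ∤ a` then `π ∣ a − 1`. [cite: Omeara1963, §63A (residue field of a dyadic prime)] -/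
private theorem dvd_sub_one_of_not_dvd (hres : ∀ t : R, π ∣ t ∨ π ∣ t - 1) {a : R} (ha : ¬ π ∣ a) : π ∣ a - 1 :=
  (hres a).resolve_left ha

/-- **Differences of unit squares at a dyadic prime of index `e` with residue field `𝔽₂`**: for `π`-units `a, c` (`2 = π^e w`, `π ∤ w`, `e ≥ 1`,
`R/(π) = {0,1}`), either `a² − c² = π^{2j}·ν` for some `1 ≤ j < e` and `π ∤ ν`, or `π^{2e+1} ∣ a² − c²`.  (`a − c = πd`, `a + c = πd + π^e wc`; with
`d = π^k d₀`, `π ∤ d₀`: `a² − c² = π^{2k+2} d₀(d₀ + π^{e−1−k}wc)` of exact order `2k+2` if `k + 1 < e`; of order `≥ 2e + 1` if `k + 1 ≥ e`, because for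
`k + 1 = e` the last factor is `d₀ + wc ≡ 1 + 1 = 2 ≡ 0 (mod π)`.) [cite: Omeara1963, §63A (63:1, 63:1a)] [cite: Serre1973CourseArithmetic, Ch. II §3.3] -/
theorem exists_sq_sub_sq_eq_or_pow_dvd [WfDvdMonoid R] (hπ : Prime π) (h2 : (2 : R) = π ^ e * w) (hw : ¬ π ∣ w) (he : 1 ≤ e)
    (hres : ∀ t : R, π ∣ t ∨ π ∣ t - 1) {a c : R} (ha : ¬ π ∣ a) (hc : ¬ π ∣ c) :
    (∃ (j : ℕ) (ν : R), 1 ≤ j ∧ j < e ∧ a ^ 2 - c ^ 2 = π ^ (2 * j) * ν ∧ ¬ π ∣ ν) ∨ π ^ (2 * e + 1) ∣ a ^ 2 - c ^ 2 := by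
  obtain ⟨ta, hta⟩ := dvd_sub_one_of_not_dvd hres ha
  obtain ⟨tc, htc⟩ := dvd_sub_one_of_not_dvd hres hc
  obtain ⟨tw, htw⟩ := dvd_sub_one_of_not_dvd hres hw
  -- `a − c = π d`
  have hd : a - c = π * (ta - tc) := by linear_combination hta - htc
  by_cases hd0 : ta - tc = 0
  · -- `a = c`
    right
    rw [hd0, mul_zero, sub_eq_zero] at hd
    rw [hd, sub_self]
    exact dvd_zero _
  obtain ⟨k, d₀, hd₀, hk⟩ := WfDvdMonoid.max_power_factor' hd0 hπ.not_unit
  obtain ⟨e', rfl⟩ := Nat.exists_eq_add_of_le' he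
  -- `a² − c² = π^{k+2} d₀ (π^k d₀ + π^{e'} w c)`
  have hsq : a ^ 2 - c ^ 2 = π ^ (k + 2) * (d₀ * (π ^ k * d₀ + π ^ e' * (w * c))) := by
    have h1 : a ^ 2 - c ^ 2 = (a - c) * ((a - c) + 2 * c) := by ring
    rw [h1, hd, hk, h2]; ring
  obtain ⟨td, htd⟩ := dvd_sub_one_of_not_dvd hres hd₀
  rcases lt_or_ge k e' with hlt | hge
  · -- exact order `2k + 2 ≤ 2e'` : `j = k + 1 < e' + 1`
    left
    obtain ⟨i, rfl⟩ := Nat.exists_eq_add_of_lt hlt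
    refine ⟨k + 1, d₀ * (d₀ + π ^ (i + 1) * (w * c)), by omega, by omega, ?_, ?_⟩
    · rw [hsq]; ring
    · intro hdiv
      rcases hπ.dvd_or_dvd hdiv with h | h
      · exact hd₀ h
      · apply hd₀
        have : π ∣ d₀ + π ^ (i + 1) * (w * c) - π ^ (i + 1) * (w * c) := dvd_sub h (Dvd.intro (π ^ i * (w * c)) (by ring))
        simpa using this
  · -- order `≥ 2e' + 3 = 2e + 1`
    right
    obtain ⟨i, rfl⟩ := Nat.exists_eq_add_of_le hge
    rw [hsq]
    rcases i with _ | i'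
    · -- `k = e'`: `d₀ + wc ≡ 1 + 1 = 2 ≡ 0 (mod π)`
      have hsum : π ∣ d₀ + w * c := by
        refine ⟨td + tw * c + tc + π ^ e' * w, ?_⟩
        linear_combination htd + c * htw + htc + h2
      obtain ⟨s, hs⟩ := hsum
      refine ⟨d₀ * s, ?_⟩
      have h1 : π ^ (e' + 0) * d₀ + π ^ e' * (w * c) = π ^ e' * (π * s) := by rw [← hs]; ring
      rw [h1]; ring
    · -- `k > e'`
      exact ⟨π ^ i' * (d₀ * (π ^ (i' + 1) * d₀ + w * c)), by ring⟩

/-- **`π^{2j+1} ∤ π^{2j}ν − πμb²` for `π ∤ ν`, `π ∤ μ`** (the first term has even order `2j`, the second odd order `1 + 2v(b)`).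
[cite: Omeara1963, §63A] -/
theorem not_pow_dvd_pow_mul_sub_of_not_dvd [IsDomain R] [WfDvdMonoid R] (hπ : Prime π) {ν μ b : R} (hν : ¬ π ∣ ν) (hμ : ¬ π ∣ μ) (j : ℕ) :
    ¬ π ^ (2 * j + 1) ∣ π ^ (2 * j) * ν - π * μ * b ^ 2 := by
  intro hdiv
  have hπ0 : π ≠ 0 := hπ.ne_zero
  by_cases hb : b = 0
  · rw [hb] at hdiv
    simp only [zero_pow two_ne_zero, mul_zero, sub_zero] at hdiv
    rw [pow_succ] at hdiv
    exact hν ((mul_dvd_mul_iff_left (pow_ne_zero _ hπ0)).mp hdiv)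
  obtain ⟨k, b₀, hb₀, rfl⟩ := WfDvdMonoid.max_power_factor' hb hπ.not_unit
  have hY : π * μ * (π ^ k * b₀) ^ 2 = π ^ (2 * k + 1) * (μ * b₀ ^ 2) := by ring
  rw [hY] at hdiv
  have hμb : ¬ π ∣ μ * b₀ ^ 2 := by
    intro h
    rcases hπ.dvd_or_dvd h with h1 | h1
    · exact hμ h1
    · exact hb₀ (hπ.dvd_of_dvd_pow h1)
  rcases lt_or_ge (2 * k + 1) (2 * j) with hlt | hge
  · -- `π^{2k+2} ∣ π^{2j}ν` and `∣` the difference, hence `∣ π^{2k+1} μ b₀²`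
    have h1 : π ^ (2 * k + 2) ∣ π ^ (2 * j) * ν := (pow_dvd_pow π (by omega)).trans (Dvd.intro ν rfl)
    have h2 : π ^ (2 * k + 2) ∣ π ^ (2 * j) * ν - π ^ (2 * k + 1) * (μ * b₀ ^ 2) := (pow_dvd_pow π (by omega)).trans hdiv
    have h3 : π ^ (2 * k + 2) ∣ π ^ (2 * k + 1) * (μ * b₀ ^ 2) := by
      have := dvd_sub h1 h2; rwa [sub_sub_cancel] at this
    rw [show π ^ (2 * k + 2) = π ^ (2 * k + 1) * π by ring] at h3
    exact hμb ((mul_dvd_mul_iff_left (pow_ne_zero _ hπ0)).mp h3)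
  · -- `2k + 1 > 2j`: `π^{2j+1} ∣ π^{2k+1} μ b₀²` hence `∣ π^{2j} ν`
    have hgt : 2 * j + 1 ≤ 2 * k + 1 := by omega
    have h1 : π ^ (2 * j + 1) ∣ π ^ (2 * k + 1) * (μ * b₀ ^ 2) := (pow_dvd_pow π hgt).trans (Dvd.intro _ rfl)
    have h3 : π ^ (2 * j + 1) ∣ π ^ (2 * j) * ν := by
      have := dvd_add hdiv h1; rwa [sub_add_cancel] at this
    rw [pow_succ] at h3
    exact hν ((mul_dvd_mul_iff_left (pow_ne_zero _ hπ0)).mp h3)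

/-- **`π^{2e} ∣ πμb²` forces `π^{2e+1} ∣ πμb²`** (`π ∤ μ`: the order of `πμb²` is odd). [cite: Omeara1963, §63A] -/
theorem pow_succ_dvd_of_pow_dvd_mul_sq [IsDomain R] [WfDvdMonoid R] (hπ : Prime π) {μ b : R} (hμ : ¬ π ∣ μ)
    (h : π ^ (2 * e) ∣ π * μ * b ^ 2) : π ^ (2 * e + 1) ∣ π * μ * b ^ 2 := by
  have hπ0 : π ≠ 0 := hπ.ne_zero
  by_cases hb : b = 0
  · rw [hb]; simp
  obtain ⟨k, b₀, hb₀, rfl⟩ := WfDvdMonoid.max_power_factor' hb hπ.not_unit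
  have hY : π * μ * (π ^ k * b₀) ^ 2 = π ^ (2 * k + 1) * (μ * b₀ ^ 2) := by ring
  rw [hY] at h ⊢
  have hμb : ¬ π ∣ μ * b₀ ^ 2 := by
    intro h'
    rcases hπ.dvd_or_dvd h' with h1 | h1
    · exact hμ h1
    · exact hb₀ (hπ.dvd_of_dvd_pow h1)
  rcases lt_or_ge (2 * k + 1) (2 * e) with hlt | hge
  · exfalso
    have h2 : π ^ (2 * k + 2) ∣ π ^ (2 * k + 1) * (μ * b₀ ^ 2) := (pow_dvd_pow π (by omega)).trans h
    rw [show π ^ (2 * k + 2) = π ^ (2 * k + 1) * π by ring] at h2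
    exact hμb ((mul_dvd_mul_iff_left (pow_ne_zero _ hπ0)).mp h2)
  · exact (pow_dvd_pow π (by omega)).trans (Dvd.intro _ rfl)

end Residue

section Descent

variable [IsDomain R] [WfDvdMonoid R] {π w μ ε : R} {e : ℕ}

/-- ★ **A unit `ε` with `π^{2e} ‖ ε − 1` is not `a² − πμ·b²` up to squares: no `a, b, c ∈ R`, `c ≠ 0`, with `a² − πμb² = c²ε`**
(`π` prime, `2 = π^e w`, `π ∤ w`, `e ≥ 1`, `R/(π) = {0,1}`, `π ∤ μ`).  Descent on the power of `π` in `c`; then for `π ∤ c`, `c²(ε − 1) = (a² − c²) − πμb²`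
has `π`-order `2e` on the left but not on the right (`exists_sq_sub_sq_eq_or_pow_dvd`, `not_pow_dvd_pow_mul_sub_of_not_dvd`, `pow_succ_dvd_of_pow_dvd_mul_sq`).
In Hilbert-symbol language: `(ε, πμ)_𝔭 = −1` for `ε ≡ 1 + π^{2e} (mod π^{2e+1})` at a dyadic prime of index `e` and degree `1` (`ε ≡ Δ = 1 + 4ρ`, the unit
whose square root generates the unramified quadratic extension); only this elementary direction is proved, without completions.  k4-w1's
`not_exists_sq_sub_mul_sq_of_pow_four_dvd` is the case `e = 2`. [cite: Omeara1963, §63B (63:10) and §63A (63:1, 63:3)] [cite: NeukirchANT1999, Ch. V §3] -/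
theorem not_exists_sq_sub_mul_sq_of_pow_two_mul_dvd (hπ : Prime π) (h2 : (2 : R) = π ^ e * w) (hw : ¬ π ∣ w) (he : 1 ≤ e)
    (hres : ∀ t : R, π ∣ t ∨ π ∣ t - 1) (hμ : ¬ π ∣ μ) (h4 : π ^ (2 * e) ∣ ε - 1) (h5 : ¬ π ^ (2 * e + 1) ∣ ε - 1) :
    ¬ ∃ a b c : R, c ≠ 0 ∧ a ^ 2 - π * μ * b ^ 2 = c ^ 2 * ε := by
  rintro ⟨a, b, c, hc, h⟩
  have hπ0 : π ≠ 0 := hπ.ne_zero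
  -- `π ∤ ε`
  have hε : ¬ π ∣ ε := by
    intro hε
    have h1 : π ∣ ε - 1 := (dvd_pow_self π (by omega)).trans h4
    have h1' : π ∣ (1 : R) := by
      have := dvd_sub hε h1
      rwa [sub_sub_cancel] at this
    exact hπ.not_unit (isUnit_of_dvd_one h1')
  obtain ⟨k, c', hc', rfl⟩ := WfDvdMonoid.max_power_factor' hc hπ.not_unit
  induction k generalizing a b with
  | zero =>
    rw [pow_zero, one_mul] at h
    -- `π ∤ a`
    have ha : ¬ π ∣ a := by
      intro hpa
      have h1 : π ∣ c' ^ 2 * ε := by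
        rw [← h]
        exact dvd_sub (dvd_pow hpa two_ne_zero) (Dvd.intro (μ * b ^ 2) (by ring))
      rcases hπ.dvd_or_dvd h1 with h3 | h3
      · exact hc' (hπ.dvd_of_dvd_pow h3)
      · exact hε h3
    -- `Δ = c'²(ε − 1) = (a² − c'²) − πμ b²`, `π^{2e} ∣ Δ`, `π^{2e+1} ∤ Δ`
    have hΔ : c' ^ 2 * (ε - 1) = (a ^ 2 - c' ^ 2) - π * μ * b ^ 2 := by linear_combination -h
    have h4Δ : π ^ (2 * e) ∣ (a ^ 2 - c' ^ 2) - π * μ * b ^ 2 := by rw [← hΔ]; exact h4.mul_left _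
    have h5Δ : ¬ π ^ (2 * e + 1) ∣ (a ^ 2 - c' ^ 2) - π * μ * b ^ 2 := by
      rw [← hΔ]
      exact fun h5' => h5 (hπ.pow_dvd_of_dvd_mul_left _ hc' (hπ.pow_dvd_of_dvd_mul_left _ hc' (by rwa [sq, mul_assoc] at h5')))
    rcases exists_sq_sub_sq_eq_or_pow_dvd hπ h2 hw he hres ha hc' with ⟨j, ν, hj1, hje, hν, hνn⟩ | hD
    · -- `a² − c'² = π^{2j} ν`, `j < e`: then `π^{2j+1} ∣ Δ`, impossible
      rw [hν] at h4Δ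
      exact not_pow_dvd_pow_mul_sub_of_not_dvd hπ hνn hμ j ((pow_dvd_pow π (by omega)).trans h4Δ)
    · -- `π^{2e+1} ∣ a² − c'²`: then `π^{2e} ∣ πμb²`, hence `π^{2e+1} ∣ πμb²` and `π^{2e+1} ∣ Δ`
      have hY : π ^ (2 * e) ∣ π * μ * b ^ 2 := by
        have := dvd_sub ((pow_dvd_pow π (by omega : 2 * e ≤ 2 * e + 1)).trans hD) h4Δ
        rwa [sub_sub_cancel] at this
      exact h5Δ (dvd_sub hD (pow_succ_dvd_of_pow_dvd_mul_sq hπ hμ hY))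
  | succ k ih =>
    -- `π ∣ a`
    have hpa : π ∣ a := by
      have h1 : π ∣ a ^ 2 := ⟨μ * b ^ 2 + π ^ (2 * k + 1) * c' ^ 2 * ε, by linear_combination h⟩
      exact hπ.dvd_of_dvd_pow h1
    obtain ⟨a', rfl⟩ := hpa
    -- `π ∣ b`
    have hpb : π ∣ b := by
      have h1 : π ∣ μ * b ^ 2 := by
        refine ⟨a' ^ 2 - π ^ (2 * k) * c' ^ 2 * ε, ?_⟩
        have h3 : π * (μ * b ^ 2) = π * (π * (a' ^ 2 - π ^ (2 * k) * c' ^ 2 * ε)) := by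
          linear_combination (-1 : R) * h
        exact mul_left_cancel₀ hπ.ne_zero h3
      rcases hπ.dvd_or_dvd h1 with h3 | h3
      · exact absurd h3 hμ
      · exact hπ.dvd_of_dvd_pow h3
    obtain ⟨b', rfl⟩ := hpb
    refine ih (a := a') (b := b') (mul_ne_zero (pow_ne_zero _ hπ.ne_zero) (right_ne_zero_of_mul hc)) ?_
    have h3 : π ^ 2 * (a' ^ 2 - π * μ * b' ^ 2) = π ^ 2 * ((π ^ k * c') ^ 2 * ε) := by linear_combination h
    exact mul_left_cancel₀ (pow_ne_zero 2 hπ.ne_zero) h3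

end Descent

section Field

variable [IsDomain R] [WfDvdMonoid R] {π w μ ε : R} {e : ℕ} (K : Type*) [Field K] [Algebra R K] [IsFractionRing R K]

omit [WfDvdMonoid R] in
/-- Clearing denominators: `x² − m y² = ε` in the fraction field gives `a² − m b² = c²ε` in `R` with `c ≠ 0`. [folklore] -/
private theorem exists_sq_sub_mul_sq_of_field {m : R} {x y : K}
    (h : x ^ 2 - algebraMap R K m * y ^ 2 = algebraMap R K ε) :
    ∃ a b c : R, c ≠ 0 ∧ a ^ 2 - m * b ^ 2 = c ^ 2 * ε := by
  obtain ⟨a₁, d₁, hd₁, hx⟩ := IsFractionRing.div_surjective (A := R) x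
  obtain ⟨a₂, d₂, hd₂, hy⟩ := IsFractionRing.div_surjective (A := R) y
  have hd₁0 : d₁ ≠ 0 := nonZeroDivisors.ne_zero hd₁
  have hd₂0 : d₂ ≠ 0 := nonZeroDivisors.ne_zero hd₂
  have hd₁K : algebraMap R K d₁ ≠ 0 := IsFractionRing.to_map_ne_zero_of_mem_nonZeroDivisors hd₁
  have hd₂K : algebraMap R K d₂ ≠ 0 := IsFractionRing.to_map_ne_zero_of_mem_nonZeroDivisors hd₂
  refine ⟨a₁ * d₂, a₂ * d₁, d₁ * d₂, mul_ne_zero hd₁0 hd₂0, ?_⟩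
  have hx' : algebraMap R K a₁ = x * algebraMap R K d₁ := by rw [← hx, div_mul_cancel₀ _ hd₁K]
  have hy' : algebraMap R K a₂ = y * algebraMap R K d₂ := by rw [← hy, div_mul_cancel₀ _ hd₂K]
  apply IsFractionRing.injective R K
  simp only [map_sub, map_mul, map_pow]
  rw [hx', hy']
  linear_combination (algebraMap R K d₁ * algebraMap R K d₂) ^ 2 * h

/-- ★ **Field form: a unit `ε` of `R` with `π^{2e} ‖ ε − 1` is not of the form `x² − πμ·y²` with `x, y` in the fraction field `K` of `R`** (`π` prime,
`2 = π^e w`, `π ∤ w`, `e ≥ 1`, `R/(π) = {0,1}`, `π ∤ μ`) — `ε` is not a norm from `K(√(πμ))` (O'Meara 63:10); the dyadic obstruction `(ε, πμ)_𝔭 = −1` at a prime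
with `e(𝔭|2) = e`, `f(𝔭|2) = 1`. [cite: Omeara1963, §63B (63:10) and §63A (63:1, 63:3)] [cite: NeukirchANT1999, Ch. V §3] -/
theorem not_exists_sq_sub_mul_sq_fractionRing_of_pow_two_mul_dvd (hπ : Prime π) (h2 : (2 : R) = π ^ e * w) (hw : ¬ π ∣ w) (he : 1 ≤ e)
    (hres : ∀ t : R, π ∣ t ∨ π ∣ t - 1) (hμ : ¬ π ∣ μ) (h4 : π ^ (2 * e) ∣ ε - 1) (h5 : ¬ π ^ (2 * e + 1) ∣ ε - 1) :
    ¬ ∃ x y : K, x ^ 2 - algebraMap R K (π * μ) * y ^ 2 = algebraMap R K ε := by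
  rintro ⟨x, y, h⟩
  obtain ⟨a, b, c, hc, habc⟩ := exists_sq_sub_mul_sq_of_field K h
  exact not_exists_sq_sub_mul_sq_of_pow_two_mul_dvd hπ h2 hw he hres hμ h4 h5 ⟨a, b, c, hc, by linear_combination habc⟩

end Field

end Summit.BirchSwinnertonDyer.BirchSwinnertonDyer.Theorems.AddKatoTwo.DyadicDescent
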